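import Summits.ResolutionOfSingularities.ResolutionOfSingularities.Theorems.EquisingularLiftEquisingularLiftNatPRamGammaSupplier
import Summits.ResolutionOfSingularities.ResolutionOfSingularities.Theorems.EquisingularLiftEquisingularLiftNatTowerBTriplePrimePointStepsFE
import Summits.ResolutionOfSingularities.ResolutionOfSingularities.Theorems.EquisingularLiftEquisingularLiftNatResidueHypDefsE7
import Summits.ResolutionOfSingularities.ResolutionOfSingularities.Theorems.EquisingularLiftEquisingularLiftNatModelStepChain
import Summits.ResolutionOfSingularities.ResolutionOfSingularities.Theorems.EquisingularLiftEquisingularLiftNatTowerExcFourEmpty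
import HarnessLib

/-!
# [OURS · L1 W4.5(b) · EL♮(3) · WIDTH TABLE D13 «(P-ram-Γ) / E-ROUND», engine delta — tower step] THE TAIL RULE `TowerPRamGamma` IS CLOSED ON THE
# ENGINE INVARIANT `INV₁‴` AT `FE`: ★★ `Tower.towerPRamGamma_invB₁_FE`

res-L1-w45b-stub-2 g20, SCRATCH for res-L1-w45b-stub-4 g15's PΓ TAIL-CLOSURE CASE (desk DESK WORD g26-12 GO, 2026-08-29T09:33:33Z: «draft … as SCRATCH under
`g20/pg/` now, in stub-4's D12 layout»; stub-4 owns the D12/D13 engine and takes this over on resume).  OURS; NOT a statement of any manuscript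
([Hironaka2017] is a candidate under adjudication, nothing of it is asserted); AI-written, weaker than expert review.  No `sorry`; standard axioms;
DEF-FREE; hypothesis-free.  `--supports stmt-ResolutionOfSingularities-20148 --as helper`, counted 0.  EL♮(3) is NOT proved.

WHAT.  The D13 tail rule ✓ `TowerPRamGamma` (res-type-027, `…NatResidueHypDefsE7` p711287 :45–:82; 3-way E-menu) holds for the engine motive
`INV₁‴ G γ T E Es Ns K := (Tower.InvB₄ FE … G γ T E Es Ns K ∧ IsClosed K ∧ K ⊆ closure (K ∖ E) ∧ K ≠ univ) ∧ hcar ∧ IsLocallyNoetherian F₉` of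
✓ `Tower.towerPtRamB₄_invB₁_FE` (…NatTowerBTriplePrimePointStepsFE, res-L1-w45b-stub-4).  TWO explicit stage steps with the centres kept in hand:
STAGE 1 = the RAM (✓ `fatPointStep_model`: the multisection `C₁` lifting the curvilinear fat point `J`, `τ = Bl_{C₁}`, the new `Ch`-stage `X″` with model
square `j₂`, `j₂ ≫ τ = υ₂ ≫ j`; every model-carrying member `F ∌ pt` transported by ✓ `Tower.exc₄_transport_away`, exactly as ✓ `Tower.invB₄_pointStep`);
STAGE 2 = the PLANE ROUND hosted by the ram's exceptional divisor: ✓ `TCPlus.ramPlane_hostModel` (the five host antecedents of `𝓔 := C₁·𝒪_{X″}`, trace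
`J·𝒪_{G′}`, (Γ2)) → ★ `ERound.eRoundLift` (the centre `C₂ ⊇ 𝓔`, regular, `O`-flat, `C₂·𝒪_{G′} = 𝓘`) → ✓ `modelStep_chain` (`D := 𝓘`; `¬ St T ⊆ supp 𝓘`
because `υ₂` is onto off `pt` and `supp 𝓘 ⊆ υ₂⁻¹ pt`) → every model-carrying member transported AGAIN by ✓ `Tower.exc₄_transport_away`, its upstairs
disjointness from `C₂` by ✓ `disjoint_support_of_disjoint_support_comap` (the traces `St F ∌` and `supp 𝓘 ⊆ υ₂⁻¹ pt` are disjoint); the E-menu's third arm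
`E″ = ∅` carries the model `⊤` (✓ `Tower.exc₄_empty_FE`, res-L1-w45b-nose-w1 g7, p712010); `Ns″` = topology (✓ `not_closure_preimage_diff_subset`
twice, the strict transform of the fat plane, the new exceptional divisor); `K″ = ∅`.
[cite: Liu2002, §8.1 and Thm. 8.1.19] [cite: GortzWedhorn2020, Prop. 13.91 (3) and (13.19)] [cite: StacksProject, Tags 02OS, 01K0] [folklore; pure
composition of the cited tree bricks]
-/

set_option linter.dupNamespace false -- mandated namespace `Summit.<Summit>.<Problem>` of this single-conjunct summit
set_option linter.overlappingInstances false -- signatures carry `[IsDomain O] [IsDiscreteValuationRing O]`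

noncomputable section

open CategoryTheory CategoryTheory.Limits AlgebraicGeometry TopologicalSpace Topology IsLocalRing
open Literature.AlgebraicGeometry.Resolution
open AlgebraicGeometry.Scheme.IdealSheafData
open Summit.ResolutionOfSingularities.ResolutionOfSingularities.Theses.EquisingularLift.Split
open Summit.ResolutionOfSingularities.ResolutionOfSingularities.Cruxes.EquisingularLift.StrataSplit

namespace Summit.ResolutionOfSingularities.ResolutionOfSingularities.Cruxes.EquisingularLiftNat.Sections

/-! ## The tail rule `TowerPRamGamma` on `INV₁‴` at `FE` -/

section PGFE

variable (O : Type) [CommRing O] [IsDomain O] [IsDiscreteValuationRing O] [IsAdicComplete (IsLocalRing.maximalIdeal O) O]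
    [IsAlgClosed (IsLocalRing.ResidueField O)] (k : Type) [Field k]
    (θ : O →+* k) (hθ : Function.Surjective θ)
    (P : Scheme.{0}) [IsIntegral P] (q : P ⟶ Spec (.of O)) [IsProper q] [SmoothOfRelativeDimension 3 q] (Y : Set P)
    (hYsp : Y ⊆ q ⁻¹' {IsLocalRing.closedPoint O}) (hYirr : IsIrreducible Y) (hYcl : IsClosed Y)
    (hPnoeth : IsLocallyNoetherian P) (hPreg : Scheme.IsRegular P)
    (Ch : ∀ X' : Scheme.{0}, (X' ⟶ P) → Set X' → Prop)
    (hChStep : ∀ (X' X'' : Scheme.{0}) (σ' : X' ⟶ P) (S' : Set X') (C : X'.IdealSheafData) (τ : X'' ⟶ X'),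
      Ch X' σ' S' → IsBlowup τ C → Scheme.IsRegular C.subscheme → Flat (C.subschemeι ≫ σ' ≫ q) →
      σ' '' (C.support : Set X') ⊆ {y | ¬ IsGenericPoint y Y} → (C.support : Set X') ∩ (σ' ≫ q) ⁻¹' {IsLocalRing.closedPoint O} ⊆ S' →
      Ch X'' (τ ≫ σ') (closure (τ ⁻¹' (S' \ (C.support : Set X')))))
    (hChSplit : ∀ (X' : Scheme.{0}) (σ' : X' ⟶ P) (S' : Set X'), Ch X' σ' S' → Chain P Y X' σ' S')

include hθ hYsp hYirr hYcl hPnoeth hPreg hChStep hChSplit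

set_option maxHeartbeats 3200000 in -- two explicit model steps with all member transports
/-- ★★ **`(P-ram-Γ)‴` ON THE ENGINE INVARIANT `INV₁‴` AT `FE`** — the D13 tail rule ✓ `TowerPRamGamma` (…NatResidueHypDefsE7 :45–:82, 3-way E-menu) is
CLOSED on `INV₁‴` (the motive of ✓ `Tower.towerPtRamB₄_invB₁_FE`): stage 1 = the ram over ✓ `fatPointStep_model` with the members transported off the
point, stage 2 = the plane round hosted by the ram's exceptional divisor (✓ `TCPlus.ramPlane_hostModel` → ★ `ERound.eRoundLift` → ✓ `modelStep_chain`) with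
the members transported off `supp 𝓘 ⊆ υ₂⁻¹ pt`.  See the module docstring. [cite: Liu2002, Thm. 8.1.19] [cite: StacksProject, Tag 02OS]
[OURS · L1 W4.5b · WIDTH TABLE D13 engine delta (scratch for res-L1-w45b-stub-4); NOT a statement of the manuscript; EL♮(3) NOT proved] -/
theorem Tower.towerPRamGamma_invB₁_FE :
    ∀ (F₉ : Scheme.{0}) (Z₉ : Set F₉) (hZ₉ : IsClosed Z₉) (F₁₀ : Scheme.{0}) (υ' : F₁₀ ⟶ F₉),
      TowerPRamGamma F₉ F₁₀ υ' Z₉ hZ₉ (fun G γ T E Es Ns K =>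
        (Tower.InvB₄ O k θ P q Y Ch (fun _ _ _ _ _ _ _ _ _ σ _ 𝓔 => Flat (𝓔.subschemeι ≫ σ ≫ q)) F₉ Z₉ hZ₉ F₁₀ υ' G γ T E Es Ns K ∧
          IsClosed K ∧ K ⊆ closure (K \ E) ∧ K ≠ Set.univ) ∧
        (∀ z : ↥(redSub F₉ Z₉ hZ₉), IsClosed ({z} : Set ↥(redSub F₉ Z₉ hZ₉)) →
          ringKrullDim ((redSub F₉ Z₉ hZ₉).presheaf.stalk z) = ((1 : ℕ) : WithBot ℕ∞)) ∧ IsLocallyNoetherian F₉) := by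
  intro F₉ Z₉ hZ₉ F₁₀ υ' G G' G'' γ T E Es Ns K y J υ₂ 𝓘 υ₃ K'' E'' Es'' Ns'' hI hTreg _hFreg hJsupp hJgen hυ₂ hJI hIT _hIne hΓ1 hPΓ hUΓ hυ₃
    hK'' hE'' hEs'' hNs''
  classical
  obtain ⟨⟨hinv, hKcl, hKE, hKne⟩, hcar, hF₉noeth⟩ := hI
  obtain ⟨hυ'bl, hZ₉inf, hGint, hTcl, hTirr, hEcl, hTE, hEsB, hNsB, X, σ, S, jG, tG, hCh, hXint, hXnoeth, hXreg, hdom, hsq, hTS, hExc, hExcF⟩ :=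
    hinv
  haveI := hGint; haveI := hXint; haveI := hXnoeth
  -- the FE datum and its iso-invariance, in the shape the transports consume
  have hRuledIso := Tower.feIsoC O P q Z₉ hZ₉ υ'
  -- ===================== the point of the ram =====================
  set pt : G := curvePt G T y with hpt
  have hyT : pt ∈ T := subschemeι_mem_of_isClosed hTcl y
  have hyc : IsClosed ({pt} : Set G) := hJsupp ▸ J.support.isClosed
  have hTy : ¬ T ⊆ {pt} := not_subset_singleton_of_not_isRegularLocalRing_stalk y hTreg hyc
  haveI : IsClosedImmersion (Spec.map (CommRingCat.ofHom θ)) := IsClosedImmersion.spec_of_surjective _ hθ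
  haveI hjci : IsClosedImmersion jG := MorphismProperty.IsStableUnderBaseChange.of_isPullback hsq.flip inferInstance
  have hjyc : IsClosed ({jG pt} : Set X) := by
    simpa only [Set.image_singleton] using hjci.isClosedEmbedding.isClosedMap _ hyc
  have hch : Chain P Y X σ S := hChSplit _ _ _ hCh
  have hyoff : ¬ IsGenericPoint (σ (jG pt)) Y :=
    not_isGenericPoint_of_image_eq hch jG hjci.isClosedEmbedding.injective hTS hjyc hTy
  obtain ⟨ℓ, hℓ, hJℓ, hli⟩ := hJgen
  -- ===================== STAGE 1: the RAM (centre kept in hand) =====================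
  obtain ⟨C₁, X'', τ, j₂, t₂, hτ, hC₁j, hC₁reg, hC₁fl, hC₁sp, hdisj, hCh'', hreg'', hnoeth'', hint'', hdom'', hprop'', -, hGnoeth, hG'int, hG'noeth,
      hT'irr, hsq₂, hcomm, hsets⟩ :=
    fatPointStep_model O k θ hθ P q Y hYsp hYirr hYcl hPnoeth hPreg 3 Ch hChSplit hChStep X σ S hCh hdom G jG tG hsq T hTS
      pt hyT hTy hyoff J hJsupp ℓ hℓ hJℓ hli G' υ₂ hυ₂
  haveI := hGnoeth; haveI := hnoeth''; haveI := hint''; haveI := hG'int; haveI := hG'noeth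
  haveI : IsProper ((τ ≫ σ) ≫ q) := hprop''
  have hch'' : Chain P Y X'' (τ ≫ σ) (closure (τ ⁻¹' (S \ (C₁.support : Set X)))) := hChSplit _ _ _ hCh''
  -- every member of `E :: Es`: closed, `T ⊄ F`, shadow-forgotten model datum
  have hmem : ∀ F ∈ E :: Es, ∃ hF : IsClosed F, ¬ T ⊆ F ∧
      Tower.Exc₄ O P q Y (fun _ _ _ _ _ _ _ _ _ σ _ 𝓔 => Flat (𝓔.subschemeι ≫ σ ≫ q)) Z₉ hZ₉ υ' G γ F hF ∅ X σ jG := by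
    intro F hF
    rcases List.mem_cons.mp hF with rfl | hF
    · exact ⟨hEcl, hTE, Tower.exc₄_forgetShadow O P q Y _ (hExc hEcl)⟩
    · exact ⟨(hEsB F hF).1, (hEsB F hF).2, hExcF F hF (hEsB F hF).1⟩
  have hmemAll : ∀ F ∈ (E :: Es) ++ Ns, IsClosed F ∧ ¬ T ⊆ F := by
    intro F hF
    rcases List.mem_append.mp hF with hF | hF
    · obtain ⟨hFcl, hTF, -⟩ := hmem F hF
      exact ⟨hFcl, hTF⟩
    · exact hNsB F hF
  -- the stage-1 transports: a model-carrying member `F ∌ pt` keeps its model on `X″` along `St F = closure υ₂⁻¹(F ∖ pt)`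
  have hRuledAway₁ : ∀ (F : Set G) (𝓕 : X.IdealSheafData),
      (∃ e : (𝓕.comap τ).subscheme ≅ 𝓕.subscheme, e.hom ≫ 𝓕.subschemeι = (𝓕.comap τ).subschemeι ≫ τ) →
      (fun _ _ _ _ _ _ _ _ _ σ _ 𝓔 => Flat (𝓔.subschemeι ≫ σ ≫ q) : Tower.RuledDatum P) F₉ Z₉ hZ₉ F₁₀ υ' G γ F X σ jG 𝓕 →
      (fun _ _ _ _ _ _ _ _ _ σ _ 𝓔 => Flat (𝓔.subschemeι ≫ σ ≫ q) : Tower.RuledDatum P) F₉ Z₉ hZ₉ F₁₀ υ' G' (υ₂ ≫ γ)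
        (closure (υ₂ ⁻¹' (F \ {pt}))) X'' (τ ≫ σ) j₂ (𝓕.comap τ) :=
    fun F 𝓕 he hR => hRuledIso G G' γ (υ₂ ≫ γ) F (closure (υ₂ ⁻¹' (F \ {pt}))) X X'' σ jG j₂ 𝓕 τ he hR
  have hExc₁ : ∀ F ∈ E :: Es, pt ∉ F → ∀ hF' : IsClosed (closure (υ₂ ⁻¹' (F \ {pt}))),
      Tower.Exc₄ O P q Y (fun _ _ _ _ _ _ _ _ _ σ _ 𝓔 => Flat (𝓔.subschemeι ≫ σ ≫ q)) Z₉ hZ₉ υ' G' (υ₂ ≫ γ)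
        (closure (υ₂ ⁻¹' (F \ {pt}))) hF' ∅ X'' (τ ≫ σ) j₂ := by
    intro F hFmem hptF
    obtain ⟨hF, -, hExcF0⟩ := hmem F hFmem
    refine Tower.exc₄_transport_away O P q Y _ hτ hυ₂ hJsupp hcomm hRuledAway₁ hF hExcF0 (Set.disjoint_singleton_left.mpr hptF)
      fun 𝓕 h𝓕 => hdisj 𝓕 ?_
    intro hmemsupp
    have h1 : pt ∈ ((𝓕.comap jG).support : Set G) := by rw [support_comap]; exact hmemsupp
    rw [h𝓕, Scheme.IdealSheafData.coe_support_vanishingIdeal] at h1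
    exact hptF h1
  -- the stage-1 running surface `T′` and its side facts
  set T' : Set G' := closure (υ₂ ⁻¹' (T \ {pt})) with hT'
  have hTnew : ¬ T' ⊆ υ₂ ⁻¹' {pt} := by
    obtain ⟨t, htT, htne⟩ := Set.not_subset.mp hTy
    have htJ : t ∉ (J.support : Set G) := by rw [hJsupp]; exact htne
    obtain ⟨t₂, ht₂⟩ := hυ₂.exists_preimage_of_notMem_support htJ
    intro hsub
    have h1 : t₂ ∈ T' := subset_closure (by rw [Set.mem_preimage, ht₂]; exact ⟨htT, htne⟩)
    have h2 := hsub h1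
    rw [Set.mem_preimage, ht₂] at h2
    exact htne h2
  have hT'F' : ∀ F ∈ (E :: Es) ++ Ns, ¬ T' ⊆ closure (υ₂ ⁻¹' (F \ {pt})) := by
    intro F hF
    obtain ⟨hFcl, hTF⟩ := hmemAll F hF
    exact not_closure_preimage_diff_subset hυ₂ hTirr hFcl hyc hTF hTy hJsupp.le
  -- ===================== STAGE 2: the PLANE ROUND hosted by the ram's exceptional divisor =====================
  -- the ram centre is off the generic point of `Y`
  have hC₁off : σ '' (C₁.support : Set X) ⊆ {p : P | ¬ IsGenericPoint p Y} := by
    rintro _ ⟨x, hx, rfl⟩ hgen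
    by_cases hxs : (σ ≫ q).base x = closedPoint O
    · have hx1 : x ∈ (C₁.support : Set X) ∩ (σ ≫ q) ⁻¹' {closedPoint O} := ⟨hx, hxs⟩
      rw [hC₁sp] at hx1
      rw [Set.mem_singleton_iff.mp hx1] at hgen
      exact hyoff hgen
    · apply hxs
      have hY : σ x ∈ Y := hgen.mem
      have h2 : q (σ x) = closedPoint O := hYsp hY
      simpa only [Scheme.Hom.comp_base, TopCat.coe_comp, Function.comp_apply] using h2
  -- the host model `𝓔 := C₁·𝒪_{X″}`, its trace `J·𝒪_{G′}` and (Γ2)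
  obtain ⟨hEpr, h𝓔0, h𝓔reg, h𝓔flat, h𝓔prop, hEoff, h𝓙, hΓ2all⟩ :=
    TCPlus.ramPlane_hostModel O k θ hθ q hYirr hYcl hXreg hτ hC₁j hC₁reg hC₁fl hC₁off hch'' j₂ t₂ hsq₂ hcomm
  -- ★ the E-ROUND LICENCE: the centre `C₂ ⊇ 𝓔` with trace `𝓘`
  obtain ⟨C₂, h𝓔C₂, hC₂reg, hC₂fl, hC₂j⟩ :=
    ERound.eRoundLift k O θ hθ X'' (τ ≫ σ) q (C₁.comap τ) hint'' hnoeth'' hreg'' hprop'' hEpr h𝓔0 h𝓔reg h𝓔flat h𝓔prop G' j₂ t₂ hsq₂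
      (J.comap υ₂) h𝓙 𝓘 hJI hΓ1 (hΓ2all 𝓘) hPΓ hUΓ
  have hC₂off : (τ ≫ σ) '' (C₂.support : Set X'') ⊆ {p : P | ¬ IsGenericPoint p Y} := by
    rintro _ ⟨x, hx, rfl⟩
    exact hEoff ⟨x, Scheme.IdealSheafData.support_antitone h𝓔C₂ hx, rfl⟩
  -- `supp 𝓘` lies in the fresh plane and is closed; `St T ⊄ supp 𝓘`
  have hIplane : (𝓘.support : Set G') ⊆ υ₂ ⁻¹' {pt} := by
    intro w hw
    have h1 : w ∈ ((J.comap υ₂).support : Set G') := Scheme.IdealSheafData.support_antitone hJI hw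
    rw [Scheme.IdealSheafData.support_comap] at h1
    have h2 : υ₂ w ∈ (J.support : Set G) := h1
    rw [hJsupp] at h2
    exact h2
  have hIcl : IsClosed (𝓘.support : Set G') := 𝓘.support.isClosed
  have hTD : ¬ T' ⊆ (𝓘.support : Set G') := fun h => hTnew (h.trans hIplane)
  -- the blow-up of `C₂`, its `Ch`-stage and the model square for `υ₃`
  obtain ⟨X₃, τ₃, hτ₃⟩ := exists_isBlowup X'' C₂
  obtain ⟨hX₃i, hX₃n, hX₃r, hX₃dom, hG''i, hirr₃, j₃, t₃, hsq₃, hcomm₃, hCh₃⟩ :=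
    modelStep_chain O k θ hθ P q Y hYirr hYcl Ch hChSplit hChStep X'' (τ ≫ σ) (closure (τ ⁻¹' (S \ (C₁.support : Set X)))) hCh'' hreg'' hdom''
      G' j₂ t₂ hsq₂ T' hsets C₂ 𝓘 hC₂j hC₂reg hC₂fl hC₂off hIT hTD X₃ τ₃ hτ₃ G'' υ₃ hυ₃
  haveI := hX₃i; haveI := hX₃n; haveI := hG''i
  -- the stage-2 running surface `T″`
  set T'' : Set G'' := closure (υ₃ ⁻¹' (T' \ (𝓘.support : Set G'))) with hT''
  have hT''ne : T''.Nonempty := hirr₃.nonempty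
  haveI : Nonempty G'' := ⟨hT''ne.some⟩
  -- the stage-2 transports: a model-carrying member of `G′` DISJOINT from `supp 𝓘` keeps its model on `X₃`
  have hRuledAway₂ : ∀ (F : Set G') (𝓕 : X''.IdealSheafData),
      (∃ e : (𝓕.comap τ₃).subscheme ≅ 𝓕.subscheme, e.hom ≫ 𝓕.subschemeι = (𝓕.comap τ₃).subschemeι ≫ τ₃) →
      (fun _ _ _ _ _ _ _ _ _ σ _ 𝓔 => Flat (𝓔.subschemeι ≫ σ ≫ q) : Tower.RuledDatum P) F₉ Z₉ hZ₉ F₁₀ υ' G' (υ₂ ≫ γ) F X'' (τ ≫ σ) j₂ 𝓕 →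
      (fun _ _ _ _ _ _ _ _ _ σ _ 𝓔 => Flat (𝓔.subschemeι ≫ σ ≫ q) : Tower.RuledDatum P) F₉ Z₉ hZ₉ F₁₀ υ' G'' (υ₃ ≫ υ₂ ≫ γ)
        (closure (υ₃ ⁻¹' (F \ (𝓘.support : Set G')))) X₃ (τ₃ ≫ τ ≫ σ) j₃ (𝓕.comap τ₃) :=
    fun F 𝓕 he hR => hRuledIso G' G'' (υ₂ ≫ γ) (υ₃ ≫ υ₂ ≫ γ) F (closure (υ₃ ⁻¹' (F \ (𝓘.support : Set G')))) X'' X₃ (τ ≫ σ) j₂ j₃ 𝓕 τ₃ he hR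
  have hdisj₂ : ∀ (F' : Set G') (hF' : IsClosed F'), Disjoint (𝓘.support : Set G') F' →
      ∀ 𝓕 : X''.IdealSheafData, 𝓕.comap j₂ = vanishingIdeal (⟨F', hF'⟩ : Closeds G') →
        Disjoint (𝓕.support : Set X'') (C₂.support : Set X'') := by
    intro F' hF' hdF' 𝓕 h𝓕
    refine disjoint_support_of_disjoint_support_comap θ hθ ((τ ≫ σ) ≫ q) j₂ t₂ hsq₂ C₂ 𝓕 ?_
    rw [h𝓕, hC₂j, Scheme.IdealSheafData.coe_support_vanishingIdeal]
    exact hdF'.symm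
  have hExc₂ : ∀ (F' : Set G') (hF' : IsClosed F'), Disjoint (𝓘.support : Set G') F' →
      Tower.Exc₄ O P q Y (fun _ _ _ _ _ _ _ _ _ σ _ 𝓔 => Flat (𝓔.subschemeι ≫ σ ≫ q)) Z₉ hZ₉ υ' G' (υ₂ ≫ γ) F' hF' ∅ X'' (τ ≫ σ) j₂ →
      ∀ hF'' : IsClosed (closure (υ₃ ⁻¹' (F' \ (𝓘.support : Set G')))),
        Tower.Exc₄ O P q Y (fun _ _ _ _ _ _ _ _ _ σ _ 𝓔 => Flat (𝓔.subschemeι ≫ σ ≫ q)) Z₉ hZ₉ υ' G'' (υ₃ ≫ υ₂ ≫ γ)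
          (closure (υ₃ ⁻¹' (F' \ (𝓘.support : Set G')))) hF'' ∅ X₃ (τ₃ ≫ τ ≫ σ) j₃ := by
    intro F' hF' hdF' hExcF'
    exact Tower.exc₄_transport_away O P q Y _ hτ₃ hυ₃ (rfl : (𝓘.support : Set G') = 𝓘.support) hcomm₃ hRuledAway₂ hF' hExcF' hdF'
      (hdisj₂ F' hF' hdF')
  -- a stage-1 transport off the point is disjoint from the fresh plane, hence from `supp 𝓘`
  have hdisjSt : ∀ F : Set G, IsClosed F → pt ∉ F → Disjoint (𝓘.support : Set G') (closure (υ₂ ⁻¹' (F \ {pt}))) := by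
    intro F hF hptF
    have hsub : closure (υ₂ ⁻¹' (F \ {pt})) ⊆ υ₂ ⁻¹' F := closure_minimal (fun z hz => hz.1) (hF.preimage υ₂.continuous)
    refine Set.disjoint_left.mpr fun w hwI hwF => ?_
    have h1 : υ₂ w = pt := hIplane hwI
    have h2 : υ₂ w ∈ F := hsub hwF
    exact hptF (h1 ▸ h2)
  -- the two-stage transport of a member `F ∌ pt` of `E :: Es`
  have hExc₁₂ : ∀ F ∈ E :: Es, pt ∉ F → ∀ hF'' : IsClosed (closure (υ₃ ⁻¹' (closure (υ₂ ⁻¹' (F \ {pt})) \ (𝓘.support : Set G')))),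
      Tower.Exc₄ O P q Y (fun _ _ _ _ _ _ _ _ _ σ _ 𝓔 => Flat (𝓔.subschemeι ≫ σ ≫ q)) Z₉ hZ₉ υ' G'' (υ₃ ≫ υ₂ ≫ γ)
        (closure (υ₃ ⁻¹' (closure (υ₂ ⁻¹' (F \ {pt})) \ (𝓘.support : Set G')))) hF'' ∅ X₃ (τ₃ ≫ τ ≫ σ) j₃ := by
    intro F hFmem hptF
    obtain ⟨hF, -, -⟩ := hmem F hFmem
    exact hExc₂ _ isClosed_closure (hdisjSt F hF hptF) (hExc₁ F hFmem hptF isClosed_closure)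
  -- side facts of `T″` against the three kinds of `Ns″` entries and the transported members
  have hT''F'' : ∀ F ∈ (E :: Es) ++ Ns, ¬ T'' ⊆ closure (υ₃ ⁻¹' (closure (υ₂ ⁻¹' (F \ {pt})) \ (𝓘.support : Set G'))) := by
    intro F hF
    exact not_closure_preimage_diff_subset hυ₃ hT'irr isClosed_closure hIcl (hT'F' F hF) hTD le_rfl
  have hT''plane : ¬ T'' ⊆ closure (υ₃ ⁻¹' (υ₂ ⁻¹' {pt} \ (𝓘.support : Set G'))) :=
    not_closure_preimage_diff_subset hυ₃ hT'irr (hyc.preimage υ₂.continuous) hIcl hTnew hTD le_rfl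
  have hT''exc : ¬ T'' ⊆ υ₃ ⁻¹' (𝓘.support : Set G') := by
    obtain ⟨t, htT, htI⟩ := Set.not_subset.mp hTD
    obtain ⟨t₃, ht₃⟩ := hυ₃.exists_preimage_of_notMem_support htI
    intro hsub
    have h1 : t₃ ∈ T'' := subset_closure (by rw [Set.mem_preimage, ht₃]; exact ⟨htT, htI⟩)
    have h2 := hsub h1
    rw [Set.mem_preimage, ht₃] at h2
    exact htI h2
  -- ===================== the new invariant =====================
  subst hK''
  have hKfacts : IsClosed (∅ : Set G'') ∧ (∅ : Set G'') ⊆ closure (∅ \ E'') ∧ (∅ : Set G'') ≠ Set.univ :=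
    ⟨isClosed_empty, Set.empty_subset _, Set.empty_ne_univ⟩
  refine ⟨⟨?_, hKfacts⟩, hcar, hF₉noeth⟩
  -- the model-carrying list
  have hEs''B : ∀ F'' ∈ Es'', IsClosed F'' ∧ ¬ T'' ⊆ F'' := by
    intro F'' hF''
    obtain ⟨F, hFmem, -, rfl⟩ := hEs'' F'' hF''
    exact ⟨isClosed_closure, hT''F'' F (List.mem_append_left _ hFmem)⟩
  have hEs''Exc : ∀ F'' ∈ Es'', ∀ hF'' : IsClosed F'',
      Tower.Exc₄ O P q Y (fun _ _ _ _ _ _ _ _ _ σ _ 𝓔 => Flat (𝓔.subschemeι ≫ σ ≫ q)) Z₉ hZ₉ υ' G'' (υ₃ ≫ υ₂ ≫ γ) F'' hF'' ∅ X₃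
        (τ₃ ≫ τ ≫ σ) j₃ := by
    intro F'' hF''
    obtain ⟨F, hFmem, hptF, rfl⟩ := hEs'' F'' hF''
    exact hExc₁₂ F hFmem hptF
  -- the model-less list
  have hNs''B : ∀ F'' ∈ Ns'', IsClosed F'' ∧ ¬ T'' ⊆ F'' := by
    intro F'' hF''
    rcases hNs'' F'' hF'' with ⟨F, hFmem, rfl⟩ | rfl | rfl
    · exact ⟨isClosed_closure, hT''F'' F hFmem⟩
    · exact ⟨isClosed_closure, hT''plane⟩
    · exact ⟨hIcl.preimage υ₃.continuous, hT''exc⟩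
  -- the stage paths, re-associated
  have hCh₃' : Ch X₃ (τ₃ ≫ τ ≫ σ) (j₃ '' T'') := by simpa only [Category.assoc] using hCh₃
  have hdom₃' : IsDominant ((τ₃ ≫ τ ≫ σ) ≫ q) := by simpa only [Category.assoc] using hX₃dom
  have hsq₃' : IsPullback j₃ t₃ ((τ₃ ≫ τ ≫ σ) ≫ q) (Spec.map (CommRingCat.ofHom θ)) := by simpa only [Category.assoc] using hsq₃
  -- the running surface, by the 3-way menu
  rcases hE'' with ⟨hyE, rfl⟩ | ⟨F, hFmem, hptF, rfl⟩ | rfl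
  · -- `E″ = St St E`, `pt ∉ E`
    refine ⟨hυ'bl, hZ₉inf, hG''i, isClosed_closure, hirr₃, isClosed_closure, hT''F'' E (List.mem_append_left _ List.mem_cons_self), hEs''B,
      hNs''B, X₃, τ₃ ≫ τ ≫ σ, _, j₃, t₃, hCh₃', hX₃i, hX₃n, hX₃r, hdom₃', hsq₃', rfl, fun hE₃ => ?_, hEs''Exc⟩
    exact hExc₁₂ E List.mem_cons_self hyE hE₃
  · -- `E″ = St St F` for a retained member `F ∌ pt`
    refine ⟨hυ'bl, hZ₉inf, hG''i, isClosed_closure, hirr₃, isClosed_closure, hT''F'' F (List.mem_append_left _ hFmem), hEs''B, hNs''B,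
      X₃, τ₃ ≫ τ ≫ σ, _, j₃, t₃, hCh₃', hX₃i, hX₃n, hX₃r, hdom₃', hsq₃', rfl, fun hE₃ => ?_, hEs''Exc⟩
    exact hExc₁₂ F hFmem hptF hE₃
  · -- `E″ = ∅` with the model `⊤`
    refine ⟨hυ'bl, hZ₉inf, hG''i, isClosed_closure, hirr₃, isClosed_empty, fun h => ?_, hEs''B, hNs''B,
      X₃, τ₃ ≫ τ ≫ σ, _, j₃, t₃, hCh₃', hX₃i, hX₃n, hX₃r, hdom₃', hsq₃', rfl, fun hE₃ => ?_, hEs''Exc⟩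
    · exact Set.not_nonempty_empty (Set.subset_empty_iff.mp h ▸ hT''ne)
    · exact Tower.exc₄_empty_FE O P q Y Z₉ hZ₉ υ' G'' (υ₃ ≫ υ₂ ≫ γ) hE₃ X₃ (τ₃ ≫ τ ≫ σ) j₃

end PGFE

end Summit.ResolutionOfSingularities.ResolutionOfSingularities.Cruxes.EquisingularLiftNat.Sections

end
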